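import Literature.MeasureTheory.Group.InvariantQuotientChainRule
import Mathlib.MeasureTheory.Integral.Lebesgue.Countable
import Mathlib.Topology.Algebra.OpenSubgroup
import HarnessLib

/-!
# Integration in stages with a discrete fibre:
`∫_{G ⧸ H} f dμ_{G/H} = c ∫_{G ⧸ L} Σ_{z ∈ L ⧸ H} f(g • z H) dμ_{G/L}` for `H` open in `L`
(Gelbart, *Automorphic forms on adele groups* (1975), (9.11)–(9.13): the passage
`∫_{Γ\G} Σ_{δ ∈ Γ(γ)\Γ} F(δ x) dx = ∫_{Γ(γ)\G} F dx`; Bourbaki, *Intégration* VII §2 no. 8)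

Topic `MeasureTheory/Group`; a corollary of the chain rule
`InvariantQuotientChainRule.exists_lintegral_eq_mul_lintegral_innerLIntegral`
(`∫_{G ⧸ H} = c ∫_{G ⧸ L} ∫_{L ⧸ H ⊓ L}` for closed `H ≤ L ≤ G` and invariant measures on the three
coset spaces). When `H` is (relatively) **open** in `L`, the fibre `L ⧸ (H ⊓ L)` is a countable
discrete space, its counting measure is an `L`-invariant Borel measure finite on compact sets
(`smulInvariantMeasure_count_quotient`, `isFiniteMeasureOnCompacts_count_of_discrete`), and the
inner integral is a sum: for non-zero `G`-invariant measures `μ_{G/H}`, `μ_{G/L}` finite on compact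
sets there is `c ∈ (0, ∞)` with

  `∫_{G ⧸ H} f dμ_{G/H} = c ∫_{G ⧸ L} ( Σ'_{z : L ⧸ H ⊓ L} f(g • z H) ) dμ_{G/L}(gL)`

for every Borel `f : G ⧸ H → [0, ∞]` (`exists_lintegral_eq_mul_lintegral_tsum`). Theorems only.

This is the measure-theoretic step from the sum over `Γ` to the sum over conjugacy classes in
the trace formula for a compact quotient (Gelbart (1975), (9.11) ⟶ (9.13), with `L = A_G · G(K)`,
`H = A_G · G(K)_γ`, `L ⧸ H ≅ G(K) ⧸ G(K)_γ`); part of the inline (D-0026) decomposition of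
`Literature.NumberTheory.Automorphic.strong_multiplicity_one_quaternionUnits`.

## References

* S. Gelbart, *Automorphic forms on adele groups*, Ann. of Math. Studies 83 (1975), §9,
  (9.11)–(9.13), Remark 9.23 [Gelbart1975].
* N. Bourbaki, *Intégration*, Ch. VII §2 no. 8; G. B. Folland, *A Course in Abstract Harmonic
  Analysis* (1995), Thm. 2.49 [Folland1995].
-/

noncomputable section

open _root_.MeasureTheory _root_.MeasureTheory.Measure _root_.Topology Set Filter
open scoped ENNReal NNReal Pointwise

/- Work with Borel structures on the coset spaces, as in `InvariantQuotientChainRule`. -/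
attribute [-instance] Quotient.instMeasurableSpace QuotientGroup.measurableSpace

namespace Literature.MeasureTheory.Group

/-! ### Counting measure on a discrete coset space -/

section Count

variable {L : Type*} [Group L] [TopologicalSpace L] [IsTopologicalGroup L] (H' : Subgroup L)
  [MeasurableSpace (L ⧸ H')] [BorelSpace (L ⧸ H')]

/-- For an open subgroup `H' ≤ L` every subset of the (discrete) coset space `L ⧸ H'` is Borel.
[folklore] -/
theorem measurableSet_of_isOpen_subgroup (hopen : IsOpen (H' : Set L)) (s : Set (L ⧸ H')) :
    MeasurableSet s := by
  haveI : DiscreteTopology (L ⧸ H') := QuotientGroup.discreteTopology hopen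
  exact (isOpen_discrete s).measurableSet

/-- **The counting measure on `L ⧸ H'` (`H'` open) is `L`-invariant**: translation by `ℓ` is a
bijection. [folklore] -/
theorem smulInvariantMeasure_count_quotient (hopen : IsOpen (H' : Set L)) :
    SMulInvariantMeasure L (L ⧸ H') (count : Measure (L ⧸ H')) := by
  haveI : DiscreteTopology (L ⧸ H') := QuotientGroup.discreteTopology hopen
  haveI : MeasurableSingletonClass (L ⧸ H') :=
    ⟨fun _ => measurableSet_of_isOpen_subgroup H' hopen _⟩
  refine ⟨fun ℓ s _ => ?_⟩
  rw [Set.preimage_smul, ← Set.image_smul, count_injective_image (MulAction.injective ℓ⁻¹)]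

/-- The counting measure on a discrete coset space is finite on compact sets (compact subsets of
a discrete space are finite). [folklore] -/
theorem isFiniteMeasureOnCompacts_count_of_discrete (hopen : IsOpen (H' : Set L)) :
    IsFiniteMeasureOnCompacts (count : Measure (L ⧸ H')) := by
  haveI : DiscreteTopology (L ⧸ H') := QuotientGroup.discreteTopology hopen
  exact ⟨fun K hK => (count_apply_lt_top' (measurableSet_of_isOpen_subgroup H' hopen K)).2
    hK.finite_of_discrete⟩

end Count

/-! ### The chain rule with a discrete fibre -/

section Discrete

variable {G : Type*} [Group G] [TopologicalSpace G] [IsTopologicalGroup G] [LocallyCompactSpace G]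
  [SecondCountableTopology G] [T2Space G] [MeasurableSpace G] [BorelSpace G]
  (H L : Subgroup G) [hH : IsClosed (H : Set G)] [hL : IsClosed (L : Set G)]
  [MeasurableSpace (G ⧸ H)] [BorelSpace (G ⧸ H)] [MeasurableSpace (G ⧸ L)] [BorelSpace (G ⧸ L)]
  [MeasurableSpace (L ⧸ H.subgroupOf L)] [BorelSpace (L ⧸ H.subgroupOf L)]
  (μGH : Measure (G ⧸ H)) [SMulInvariantMeasure G (G ⧸ H) μGH] [IsFiniteMeasureOnCompacts μGH]
  (μGL : Measure (G ⧸ L)) [SMulInvariantMeasure G (G ⧸ L) μGL] [IsFiniteMeasureOnCompacts μGL]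

omit [LocallyCompactSpace G] [SecondCountableTopology G] [T2Space G] [MeasurableSpace G]
  [BorelSpace G] hH hL [MeasurableSpace (G ⧸ H)] [BorelSpace (G ⧸ H)] [MeasurableSpace (G ⧸ L)]
  [BorelSpace (G ⧸ L)] in
/-- With the counting measure on the discrete fibre, the inner integral of the chain rule is a
sum: `innerLIntegral H L count f (gL) = Σ'_{z} f(g • zH)`. [folklore] -/
theorem innerLIntegral_count_mk (hopen : IsOpen ((H.subgroupOf L : Subgroup L) : Set L))
    (f : G ⧸ H → ℝ≥0∞) (g : G) :
    @innerLIntegral G _ _ _ H L _ _ (count : Measure (L ⧸ H.subgroupOf L))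
        (smulInvariantMeasure_count_quotient (H.subgroupOf L) hopen) f (QuotientGroup.mk g) =
      ∑' z : L ⧸ H.subgroupOf L, f (g • inclQuot H L z) := by
  haveI : DiscreteTopology (L ⧸ H.subgroupOf L) := QuotientGroup.discreteTopology hopen
  haveI : MeasurableSingletonClass (L ⧸ H.subgroupOf L) :=
    ⟨fun _ => measurableSet_of_isOpen_subgroup (H.subgroupOf L) hopen _⟩
  haveI := smulInvariantMeasure_count_quotient (H.subgroupOf L) hopen
  rw [innerLIntegral_mk, lintegral_count]

/-- **Integration in stages with a discrete fibre** (Gelbart (1975), (9.11)–(9.13):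
`∫_{Γ\G} Σ_{δ ∈ Γ(γ)\Γ} F(δx) dx = ∫_{Γ(γ)\G} F dx`; Bourbaki, *Intégration* VII §2 no. 8). Let
`H ≤ L ≤ G` be closed subgroups of a locally compact second countable Hausdorff group with `H`
relatively open in `L`, and `μ_{G/H}`, `μ_{G/L}` non-zero `G`-invariant Borel measures on `G ⧸ H`,
`G ⧸ L` finite on compact sets. Then there is `c ∈ (0, ∞)` such that for every Borel
`f : G ⧸ H → [0, ∞]`,
`∫_{G ⧸ H} f dμ_{G/H} = c ∫_{G ⧸ L} (Σ'_{z : L ⧸ H ⊓ L} f(ỹ • zH)) dμ_{G/L}(y)`, `ỹ` any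
representative of `y` (here `y.out`), the sum being over the countable discrete fibre
(`inclQuot H L : L ⧸ (H ⊓ L) → G ⧸ H`; the sum does not depend on the representative). It is the
chain rule `exists_lintegral_eq_mul_lintegral_innerLIntegral` with the counting measure of
`L ⧸ (H ⊓ L)`, which is `L`-invariant and finite on compact sets
(`smulInvariantMeasure_count_quotient`, `isFiniteMeasureOnCompacts_count_of_discrete`).
[cite: Gelbart1975, (9.11)–(9.13)] -/
theorem exists_lintegral_eq_mul_lintegral_tsum (hHL : H ≤ L)
    (hopen : IsOpen ((H.subgroupOf L : Subgroup L) : Set L)) (hGH : μGH ≠ 0) (hGL : μGL ≠ 0) :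
    ∃ c : ℝ≥0∞, c ≠ 0 ∧ c ≠ ∞ ∧ ∀ f : G ⧸ H → ℝ≥0∞, Measurable f →
      ∫⁻ x, f x ∂μGH =
        c * ∫⁻ y, ∑' z : L ⧸ H.subgroupOf L, f ((y.out : G) • inclQuot H L z) ∂μGL := by
  haveI : DiscreteTopology (L ⧸ H.subgroupOf L) := QuotientGroup.discreteTopology hopen
  haveI : MeasurableSingletonClass (L ⧸ H.subgroupOf L) :=
    ⟨fun _ => measurableSet_of_isOpen_subgroup (H.subgroupOf L) hopen _⟩
  haveI := smulInvariantMeasure_count_quotient (H.subgroupOf L) hopen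
  haveI := isFiniteMeasureOnCompacts_count_of_discrete (H.subgroupOf L) hopen
  have hcount : (count : Measure (L ⧸ H.subgroupOf L)) ≠ 0 := by
    intro h0
    have h1 : (count : Measure (L ⧸ H.subgroupOf L)) {QuotientGroup.mk 1} = 0 := by rw [h0]; rfl
    rw [count_singleton] at h1
    exact one_ne_zero h1
  obtain ⟨c, hc0, hctop, hc⟩ := exists_lintegral_eq_mul_lintegral_innerLIntegral H L μGH μGL
    (count : Measure (L ⧸ H.subgroupOf L)) hHL hGH hGL hcount
  refine ⟨c, hc0, hctop, fun f hf => ?_⟩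
  rw [hc f hf]
  congr 1
  refine lintegral_congr fun y => ?_
  conv_lhs => rw [← QuotientGroup.out_eq' y]
  rw [innerLIntegral_mk, lintegral_count]

end Discrete

end Literature.MeasureTheory.Group
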